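import Summits.ResolutionOfSingularities.ResolutionOfSingularities.Theorems.EquisingularLiftEquisingularLiftNatCompleteIntersectionLiftJacobian
import Summits.ResolutionOfSingularities.ResolutionOfSingularities.Theorems.EquisingularLiftEquisingularLiftNatCompleteIntersectionLiftProj
import Summits.ResolutionOfSingularities.ResolutionOfSingularities.Theorems.EquisingularLiftEquisingularLiftNatEmbeddedLiftNose
import Literature.AlgebraicGeometry.Resolution.SubschemeRegularStalks
import Literature.AlgebraicGeometry.Resolution.SmoothOfRegularPerfectField
import Literature.AlgebraicGeometry.Resolution.ProjectiveSpaceRegular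
import Literature.AlgebraicGeometry.Resolution.JacobianCriterion
import HarnessLib

/-!
# [OURS · L1 W4.5(b) · EL♮(3)] T-LIFT-CI, piece T4: the SMOOTH upgrade — a flat lift `V((F̃)~) ⊂ ℙⁿ_O` of a smooth complete
# intersection `V((f)~) ⊂ ℙⁿ_k` (Jacobian-minor clause) is SMOOTH over `Spec O`

Cell `res-hironaka`, rung L, slot W4.5(b); crux **EL♮(3)** (stmt-ResolutionOfSingularities-20148), registered stub
`stub_elnat_ciNoseThenPoints` (res-L1-w45b-lead-2 RESHAPE v6, 2026-08-27T08:54:27Z); cut (L1) T-LIFT-CI of res-D-pv-027 AS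
res-L1-s36-pv-4, piece T4 asked of res-type-051 (2026-08-27T09:46:40Z, TAKING 09:52:38Z). OURS; NOT a statement of any manuscript;
AI-written, weaker than expert review. No definition, no `sorry`, standard axioms. `--supports stmt-ResolutionOfSingularities-20148 --as helper`.

WHAT. `O` a DVR with a surjection `π : O → k` onto a PERFECT field `k` (e.g. algebraically closed), `φ` the graded coefficient map
(`φ s = MvPolynomial.map π s`), homogeneous `F̃_l ∈ O[x₀..xₙ]` of degrees `d_l` with reductions `f_l = π F̃_l`, and the nose
`C = (F̃)~ = projIdealSheaf 𝒜_O ⟨(F̃), _⟩ ⊂ ℙⁿ_O` (res-D-pv-027's spelling, p518108). IF the Jacobian-minor clause of the stub holds at every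
point `y` of `ℙⁿ_k` with all `f_l ∈ 𝔮_y` AND `V(C) → Spec O` is FLAT (res-D-pv-027's P4 `CILift.isRegular_and_flat_ciNose`, p520182), THEN
`V(C) → Spec O` is SMOOTH — hypothesis (a) of the v6-NONISO rung in res-type-051's currency (`elNatBody_of_noseThenPoints`, p513523).

ROUTE (consumer side; no new commutative algebra). res-type-027's `EmbeddedLift.LiftsEmbedded.smooth` (p516887: an `O`-flat closed
subscheme of `ℙⁿ_O` whose scheme-theoretic special fibre is a SMOOTH `k`-scheme is smooth over `O` — Stacks 01V8 at the special fibre,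
spread over the local base) with `S := V((f)~)`, `ι := (f)~.subschemeι`:
* `(F̃)~ · 𝒪_{ℙⁿ_k} = (f)~ = ι.ker` — res-D-pv-027's base change `CILift.comap_projIdealSheaf_span` (p518108) + Mathlib `ker_subschemeι`;
* `V((f)~)` is a REGULAR scheme — Literature `Scheme.isRegular_subscheme_of_forall` (quotient stalks `𝒪_{ℙⁿ_k,y} / (f)_y`), the stalk
  generators `germ_y (f_l / x_i^{d_l})` (res-D-pv-027's `CILift.stalkIdeal_projIdealSheaf_span`), their cotangent independence = CI-JAC
  `CILift.downstairs_stalk_of_jacobian` (p520360) + Literature `linearIndependent_toCotangent_of_forall_family`, and Matsumura 14.2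
  (`CILift.isRegularLocalRing_quotient_span_image`, P1 p517176) in the regular local ring `𝒪_{ℙⁿ_k,y}` (`isRegular_projectiveSpace`);
* regular + locally of finite type over a perfect field ⇒ smooth (Literature `smooth_of_isRegular_of_perfectField`, Stacks 00TV).

* `CILift.exists_X_not_mem` — a point of `ℙⁿ_k` misses some coordinate hyperplane;
* `CILift.germ_mk₁_mem_maximalIdeal_iff` — `germ_y (f / x_iᵈ) ∈ 𝔪_y ↔ f ∈ 𝔮_y` (`y ∈ D₊(x_i)`);
* `CILift.mem_asHomogeneousIdeal_of_mem_support_projIdealSheaf` — `y ∈ supp (f)~ ⇒ f_l ∈ 𝔮_y`;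
* `CILift.isRegular_subscheme_projIdealSheaf_of_jacobian` — `V((f)~)` regular under the Jacobian-minor clause;
* `CILift.smooth_subschemeι_projIdealSheaf_of_jacobian` — `V((f)~) → Spec k` smooth (`k` perfect);
* `CILift.smooth_ciNose_of_flat` — **T4**: `Flat (V((F̃)~) → Spec O)` + Jacobian clause downstairs ⇒ `Smooth (V((F̃)~) → Spec O)`.

References: Stacks 01V8, 00TV [StacksProject]; H. Matsumura, *Commutative Ring Theory*, Thm. 14.2, §30 [Matsumura1987]; R. Hartshorne,
*Deformation Theory* (2010), Thm. 22.3 context [Hartshorne2010]; cell: res-D-pv-027 ASK 2026-08-27T09:46:40Z, p516887 / p518108 / p520182 / p520360.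
-/

set_option linter.dupNamespace false -- mandated namespace `Summit.<Summit>.<Problem>` of this single-conjunct summit
set_option linter.overlappingInstances false -- signatures carry `[IsDomain O] [IsDiscreteValuationRing O]` as in the item

noncomputable section

open CategoryTheory AlgebraicGeometry TopologicalSpace IsLocalRing
open MvPolynomial HomogeneousLocalization
open Literature.AlgebraicGeometry.Resolution
open AlgebraicGeometry.Scheme.IdealSheafData

attribute [local instance] MvPolynomial.gradedAlgebra

namespace Summit.ResolutionOfSingularities.ResolutionOfSingularities.Cruxes.EquisingularLiftNat.Sections

namespace CILift

/-! ## Downstairs: the special fibre `V((f)~) ⊂ ℙⁿ_k` is regular, hence smooth over a perfect `k` -/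

section Downstairs

variable {k : Type} [Field k] {n c : ℕ}

/-- A point of `ℙⁿ_k` lies on some standard chart `D₊(x_i)` (its prime is relevant). [cite: Hartshorne1977, II Prop. 2.5 (proof)] -/
theorem exists_X_not_mem (y : Proj (homogeneousSubmodule (Fin (n + 1)) k)) :
    ∃ i : Fin (n + 1), (X i : MvPolynomial (Fin (n + 1)) k) ∉ y.asHomogeneousIdeal := by
  by_contra h
  simp only [not_exists, not_not] at h
  apply y.not_irrelevant_le
  refine toIdeal_le_toIdeal_iff.mp ?_
  refine (Literature.AlgebraicGeometry.Motives.ProjectiveSpace.irrelevant_le_span (n := n) (k := k)).trans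
    (Ideal.span_le.mpr ?_)
  rintro _ ⟨i, rfl⟩
  exact h i

/-- **`germ_y (f / x_iᵈ) ∈ 𝔪_y ↔ f ∈ 𝔮_y`** for `y ∈ D₊(x_i)` and `f` homogeneous of degree `d`: under `𝒪_{ℙⁿ_k,y} ≅ (k[x]_𝔮)₀ ⊆ k[x]_𝔮`
(`Proj.stalkIso'`, units detected by `isUnit_iff_isUnit_val`) the germ has value `f / x_iᵈ` with `x_iᵈ` a unit.
[cite: Hartshorne1977, II Prop. 2.5 (proof)] -/
theorem germ_mk₁_mem_maximalIdeal_iff (i : Fin (n + 1)) (y : Proj (homogeneousSubmodule (Fin (n + 1)) k))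
    (hyi : y ∈ Proj.basicOpen (homogeneousSubmodule (Fin (n + 1)) k) (X i)) (dl : ℕ) (fl : MvPolynomial (Fin (n + 1)) k)
    (hfl : fl ∈ homogeneousSubmodule (Fin (n + 1)) k dl) :
    ((Proj (homogeneousSubmodule (Fin (n + 1)) k)).presheaf.germ
          (Proj.basicOpen (homogeneousSubmodule (Fin (n + 1)) k) (X i)) y hyi).hom
        ((Proj.awayToSection (homogeneousSubmodule (Fin (n + 1)) k) (X i)).hom
          (mk₁ (homogeneousSubmodule (Fin (n + 1)) k) (X_mem_one'' i) dl fl hfl)) ∈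
        maximalIdeal ((Proj (homogeneousSubmodule (Fin (n + 1)) k)).presheaf.stalk y) ↔
      fl ∈ y.asHomogeneousIdeal := by
  let ε : ((Proj (homogeneousSubmodule (Fin (n + 1)) k)).presheaf.stalk y) ≃+*
      HomogeneousLocalization.AtPrime (homogeneousSubmodule (Fin (n + 1)) k) y.asHomogeneousIdeal.toIdeal :=
    Proj.stalkIso' (homogeneousSubmodule (Fin (n + 1)) k) y
  set z := ((Proj (homogeneousSubmodule (Fin (n + 1)) k)).presheaf.germ
      (Proj.basicOpen (homogeneousSubmodule (Fin (n + 1)) k) (X i)) y hyi).hom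
    ((Proj.awayToSection (homogeneousSubmodule (Fin (n + 1)) k) (X i)).hom
      (mk₁ (homogeneousSubmodule (Fin (n + 1)) k) (X_mem_one'' i) dl fl hfl)) with hz
  have hv : (ε z).val * algebraMap (MvPolynomial (Fin (n + 1)) k) (Localization.AtPrime y.asHomogeneousIdeal.toIdeal) (X i ^ dl) =
      algebraMap (MvPolynomial (Fin (n + 1)) k) (Localization.AtPrime y.asHomogeneousIdeal.toIdeal) fl :=
    val_stalkIso'_germ_awayToSection_mk₁ i y hyi dl fl hfl
  have hXi : (X i : MvPolynomial (Fin (n + 1)) k) ∉ y.asHomogeneousIdeal.toIdeal := hyi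
  have hXpow : (X i : MvPolynomial (Fin (n + 1)) k) ^ dl ∈ y.asHomogeneousIdeal.toIdeal.primeCompl :=
    fun h => hXi (Ideal.IsPrime.mem_of_pow_mem inferInstance _ h)
  have hu : IsUnit (algebraMap (MvPolynomial (Fin (n + 1)) k) (Localization.AtPrime y.asHomogeneousIdeal.toIdeal) (X i ^ dl)) :=
    IsLocalization.map_units _ ⟨_, hXpow⟩
  rw [mem_maximalIdeal, mem_nonunits_iff]
  constructor
  · intro hzu
    by_contra hfq
    have hfu : IsUnit (algebraMap (MvPolynomial (Fin (n + 1)) k) (Localization.AtPrime y.asHomogeneousIdeal.toIdeal) fl) :=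
      IsLocalization.map_units _ ⟨fl, show fl ∈ y.asHomogeneousIdeal.toIdeal.primeCompl from hfq⟩
    -- `(ε z).val = fl · (x_iᵈ)⁻¹` is a unit, hence `z` is a unit
    have hvu : IsUnit (ε z).val := by
      have h2 : (ε z).val = algebraMap _ (Localization.AtPrime y.asHomogeneousIdeal.toIdeal) fl * ((hu.unit⁻¹ : _ˣ) : _) := by
        rw [← hv, mul_assoc, IsUnit.mul_val_inv, mul_one]
      rw [h2]
      exact hfu.mul (Units.isUnit _)
    exact hzu ((MulEquiv.isUnit_map ε).mp ((isUnit_iff_isUnit_val _ _ (ε z)).mp hvu))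
  · intro hfq hzu
    have hfm : algebraMap (MvPolynomial (Fin (n + 1)) k) (Localization.AtPrime y.asHomogeneousIdeal.toIdeal) fl ∈
        maximalIdeal (Localization.AtPrime y.asHomogeneousIdeal.toIdeal) :=
      (IsLocalization.AtPrime.to_map_mem_maximal_iff _ y.asHomogeneousIdeal.toIdeal fl).mpr hfq
    have hvu : IsUnit (ε z).val := ((isUnit_iff_isUnit_val _ _ (ε z)).mpr (hzu.map ε))
    have : IsUnit (algebraMap (MvPolynomial (Fin (n + 1)) k) (Localization.AtPrime y.asHomogeneousIdeal.toIdeal) fl) := by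
      rw [← hv]; exact hvu.mul hu
    exact (mem_maximalIdeal _ |>.mp hfm) this

/-- **`y ∈ supp (f)~ ⇒ f_l ∈ 𝔮_y`**: on a chart `D₊(x_i) ∋ y` the ideal of `(f)~` is spanned by the sections `f_l / x_i^{d_l}`
(`projIdealSheaf_ideal_basicOpen_span`), a support point is in the zero locus of each of them (Mathlib `mem_support_iff_of_mem`,
`mem_zeroLocus_iff`, `mem_basicOpen`), i.e. their germs are non-units. [cite: Hartshorne1977, II Prop. 5.9 (proof)] -/
theorem mem_asHomogeneousIdeal_of_mem_support_projIdealSheaf (f : Fin c → MvPolynomial (Fin (n + 1)) k) (d : Fin c → ℕ)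
    (hf : ∀ l, f l ∈ homogeneousSubmodule (Fin (n + 1)) k (d l)) (y : Proj (homogeneousSubmodule (Fin (n + 1)) k))
    (hy : y ∈ (projIdealSheaf (homogeneousSubmodule (Fin (n + 1)) k)
      ⟨Ideal.span (Set.range f), isHomogeneous_span_of_forall_mem _ f d hf⟩).support) (l : Fin c) :
    f l ∈ y.asHomogeneousIdeal := by
  obtain ⟨i, hi⟩ := exists_X_not_mem y
  have hyi : y ∈ Proj.basicOpen (homogeneousSubmodule (Fin (n + 1)) k) (X i) := hi
  let U : (Proj (homogeneousSubmodule (Fin (n + 1)) k)).affineOpens :=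
    ⟨Proj.basicOpen (homogeneousSubmodule (Fin (n + 1)) k) (X i),
      Proj.isAffineOpen_basicOpen (homogeneousSubmodule (Fin (n + 1)) k) (X i) (X_mem_one'' i) one_pos⟩
  rw [Scheme.IdealSheafData.mem_support_iff_of_mem (U := U) hyi, Scheme.mem_zeroLocus_iff] at hy
  have hsec : (Proj.awayToSection (homogeneousSubmodule (Fin (n + 1)) k) (X i)).hom
      (mk₁ (homogeneousSubmodule (Fin (n + 1)) k) (X_mem_one'' i) (d l) (f l) (hf l)) ∈
      (projIdealSheaf (homogeneousSubmodule (Fin (n + 1)) k)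
        ⟨Ideal.span (Set.range f), isHomogeneous_span_of_forall_mem _ f d hf⟩).ideal U := by
    change _ ∈ (projIdealSheaf (homogeneousSubmodule (Fin (n + 1)) k) _).ideal ⟨Proj.basicOpen _ (X i), _⟩
    rw [projIdealSheaf_ideal_basicOpen_span _ f d hf _ (X_mem_one'' i)]
    exact Ideal.subset_span ⟨l, rfl⟩
  have h := hy _ hsec
  have hm : ((Proj (homogeneousSubmodule (Fin (n + 1)) k)).presheaf.germ
        (Proj.basicOpen (homogeneousSubmodule (Fin (n + 1)) k) (X i)) y hyi).hom
      ((Proj.awayToSection (homogeneousSubmodule (Fin (n + 1)) k) (X i)).hom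
        (mk₁ (homogeneousSubmodule (Fin (n + 1)) k) (X_mem_one'' i) (d l) (f l) (hf l))) ∈
      maximalIdeal ((Proj (homogeneousSubmodule (Fin (n + 1)) k)).presheaf.stalk y) := by
    rw [mem_maximalIdeal, mem_nonunits_iff]
    exact fun hu => h (((Proj (homogeneousSubmodule (Fin (n + 1)) k)).mem_basicOpen _ y hyi).mpr hu)
  exact (germ_mk₁_mem_maximalIdeal_iff i y hyi (d l) (f l) (hf l)).mp hm

/-- **`V((f)~)` is a REGULAR scheme under the Jacobian-minor clause.** `k` a field, `f_l` homogeneous of degrees `d_l`, and at every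
`y ∈ ℙⁿ_k` with all `f_l ∈ 𝔮_y` some `c × c` minor `det (∂f_i/∂x_{e j}) ∉ 𝔮_y`. Then every quotient stalk `𝒪_{ℙⁿ_k,y} / (f)_y`
(`y ∈ supp (f)~`) is a regular local ring — the germs `f_l / x_i^{d_l}` generate `(f)_y` and are cotangent-independent by CI-JAC, and
`𝒪_{ℙⁿ_k,y}` is regular — so `V((f)~)` is regular. [cite: Matsumura1987, Thm. 14.2 and Thm. 30.4] -/
theorem isRegular_subscheme_projIdealSheaf_of_jacobian (f : Fin c → MvPolynomial (Fin (n + 1)) k) (d : Fin c → ℕ)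
    (hf : ∀ l, f l ∈ homogeneousSubmodule (Fin (n + 1)) k (d l))
    (hJ : ∀ y : Proj (homogeneousSubmodule (Fin (n + 1)) k), (∀ l, f l ∈ y.asHomogeneousIdeal) →
      ∃ e : Fin c ↪ Fin (n + 1), (Matrix.of fun i j => pderiv (e j) (f i)).det ∉ y.asHomogeneousIdeal) :
    Scheme.IsRegular (projIdealSheaf (homogeneousSubmodule (Fin (n + 1)) k)
      ⟨Ideal.span (Set.range f), isHomogeneous_span_of_forall_mem _ f d hf⟩).subscheme := by
  classical
  obtain ⟨hsm, -⟩ := Summit.ResolutionOfSingularities.ResolutionOfSingularities.Cruxes.EquisingularLift.StrataSplit.stub_projectiveAmbientSmoothProper k n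
  haveI : IsLocallyNoetherian (Proj (homogeneousSubmodule (Fin (n + 1)) k)) := by
    haveI := hsm
    exact LocallyOfFiniteType.isLocallyNoetherian
      (Proj.toSpecZero (homogeneousSubmodule (Fin (n + 1)) k) ≫
        Spec.map (CommRingCat.ofHom (algebraMap k ((homogeneousSubmodule (Fin (n + 1)) k) 0))))
  refine Scheme.isRegular_subscheme_of_forall _ fun y hy => ?_
  have hfy : ∀ l, f l ∈ y.asHomogeneousIdeal := mem_asHomogeneousIdeal_of_mem_support_projIdealSheaf f d hf y hy
  obtain ⟨i, hi⟩ := exists_X_not_mem y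
  have hyi : y ∈ Proj.basicOpen (homogeneousSubmodule (Fin (n + 1)) k) (X i) := hi
  -- `𝒪_{ℙⁿ_k,y}` is a regular local ring
  haveI : IsRegularLocalRing ((Proj (homogeneousSubmodule (Fin (n + 1)) k)).presheaf.stalk y) :=
    isRegular_projectiveSpace n k y
  -- the stalk ideal is spanned by the germs of `f_l / x_i^{d_l}`, which are cotangent-independent by CI-JAC
  rw [stalkIdeal_projIdealSheaf_span f d hf i y hyi]
  set g : Fin c → (Proj (homogeneousSubmodule (Fin (n + 1)) k)).presheaf.stalk y := fun l =>
    ((Proj (homogeneousSubmodule (Fin (n + 1)) k)).presheaf.germ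
        (Proj.basicOpen (homogeneousSubmodule (Fin (n + 1)) k) (X i)) y hyi).hom
      ((Proj.awayToSection (homogeneousSubmodule (Fin (n + 1)) k) (X i)).hom
        (mk₁ (homogeneousSubmodule (Fin (n + 1)) k) (X_mem_one' i) (d l) (f l) (hf l))) with hg
  have hgm : ∀ l, g l ∈ maximalIdeal ((Proj (homogeneousSubmodule (Fin (n + 1)) k)).presheaf.stalk y) :=
    fun l => (germ_mk₁_mem_maximalIdeal_iff i y hyi (d l) (f l) (hf l)).mpr (hfy l)
  have hdown := downstairs_stalk_of_jacobian f d hf y hfy (hJ y hfy) i hyi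
  have hli := linearIndependent_toCotangent_of_forall_family g hgm hdown
  have h := isRegularLocalRing_quotient_span_image g hgm hli Set.univ
  rwa [Set.image_univ] at h

/-- **`V((f)~) → Spec k` is SMOOTH** for `k` perfect, under the Jacobian-minor clause (regular + locally of finite type over a perfect
field, Stacks 00TV). [cite: Matsumura1987, §30] -/
theorem smooth_subschemeι_projIdealSheaf_of_jacobian [PerfectField k] (f : Fin c → MvPolynomial (Fin (n + 1)) k) (d : Fin c → ℕ)
    (hf : ∀ l, f l ∈ homogeneousSubmodule (Fin (n + 1)) k (d l))
    (hJ : ∀ y : Proj (homogeneousSubmodule (Fin (n + 1)) k), (∀ l, f l ∈ y.asHomogeneousIdeal) →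
      ∃ e : Fin c ↪ Fin (n + 1), (Matrix.of fun i j => pderiv (e j) (f i)).det ∉ y.asHomogeneousIdeal) :
    Smooth ((projIdealSheaf (homogeneousSubmodule (Fin (n + 1)) k)
        ⟨Ideal.span (Set.range f), isHomogeneous_span_of_forall_mem _ f d hf⟩).subschemeι ≫
      (Proj.toSpecZero (homogeneousSubmodule (Fin (n + 1)) k) ≫
        Spec.map (CommRingCat.ofHom (algebraMap k ((homogeneousSubmodule (Fin (n + 1)) k) 0))))) := by
  obtain ⟨hsm, -⟩ := Summit.ResolutionOfSingularities.ResolutionOfSingularities.Cruxes.EquisingularLift.StrataSplit.stub_projectiveAmbientSmoothProper k n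
  haveI := hsm
  haveI : LocallyOfFiniteType ((projIdealSheaf (homogeneousSubmodule (Fin (n + 1)) k)
        ⟨Ideal.span (Set.range f), isHomogeneous_span_of_forall_mem _ f d hf⟩).subschemeι ≫
      (Proj.toSpecZero (homogeneousSubmodule (Fin (n + 1)) k) ≫
        Spec.map (CommRingCat.ofHom (algebraMap k ((homogeneousSubmodule (Fin (n + 1)) k) 0))))) := inferInstance
  exact smooth_of_isRegular_of_perfectField _ (isRegular_subscheme_projIdealSheaf_of_jacobian f d hf hJ)

end Downstairs

/-! ## T4: the flat nose `V((F̃)~) → Spec O` is smooth -/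

section Smooth

variable {O : Type} [CommRing O] [IsDomain O] [IsDiscreteValuationRing O] {k : Type} [Field k] [PerfectField k]
  (π : O →+* k) (hπ : Function.Surjective π) {n c : ℕ}
  (φ : (homogeneousSubmodule (Fin (n + 1)) O) →+*ᵍ (homogeneousSubmodule (Fin (n + 1)) k))
  (hφ' : HomogeneousIdeal.irrelevant (homogeneousSubmodule (Fin (n + 1)) k) ≤
    (HomogeneousIdeal.irrelevant (homogeneousSubmodule (Fin (n + 1)) O)).map φ)
  (hφ : ∀ s, φ s = MvPolynomial.map π s)
  (F : Fin c → MvPolynomial (Fin (n + 1)) O) (f : Fin c → MvPolynomial (Fin (n + 1)) k) (d : Fin c → ℕ)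
  (hF : ∀ l, F l ∈ homogeneousSubmodule (Fin (n + 1)) O (d l)) (hf : ∀ l, f l ∈ homogeneousSubmodule (Fin (n + 1)) k (d l))
  (hFf : ∀ l, MvPolynomial.map π (F l) = f l)

include hπ hφ hφ' hf hFf in
/-- **T4 — THE SMOOTH UPGRADE.** `O` a DVR, `π : O → k` a surjection onto a perfect field, `φ` the graded coefficient map, `F̃_l` homogeneous
of degrees `d_l` with reductions `f_l`; suppose the Jacobian-minor clause holds at every `y ∈ ℙⁿ_k` with all `f_l ∈ 𝔮_y`, and the nose
`V((F̃)~) → Spec O` is FLAT (res-D-pv-027's P4). Then `V((F̃)~) → Spec O` is SMOOTH: it is an embedded `O`-lift (`LiftsEmbedded`: flat, with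
`(F̃)~ · 𝒪_{ℙⁿ_k} = (f)~` by `comap_projIdealSheaf_span`) of the smooth `k`-scheme `V((f)~)` (`smooth_subschemeι_projIdealSheaf_of_jacobian`),
so res-type-027's `EmbeddedLift.LiftsEmbedded.smooth` (Stacks 01V8 + spreading over the local base) applies.
[cite: StacksProject, Tag 01V8] -/
theorem smooth_ciNose_of_flat
    (hJ : ∀ y : Proj (homogeneousSubmodule (Fin (n + 1)) k), (∀ l, f l ∈ y.asHomogeneousIdeal) →
      ∃ e : Fin c ↪ Fin (n + 1), (Matrix.of fun i j => pderiv (e j) (f i)).det ∉ y.asHomogeneousIdeal)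
    (hflat : Flat ((projIdealSheaf (homogeneousSubmodule (Fin (n + 1)) O)
        ⟨Ideal.span (Set.range F), isHomogeneous_span_of_forall_mem _ F d hF⟩).subschemeι ≫
      Proj.toSpecZero (homogeneousSubmodule (Fin (n + 1)) O) ≫
        Spec.map (CommRingCat.ofHom (algebraMap O ((homogeneousSubmodule (Fin (n + 1)) O) 0))))) :
    Smooth ((projIdealSheaf (homogeneousSubmodule (Fin (n + 1)) O)
        ⟨Ideal.span (Set.range F), isHomogeneous_span_of_forall_mem _ F d hF⟩).subschemeι ≫
      Proj.toSpecZero (homogeneousSubmodule (Fin (n + 1)) O) ≫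
        Spec.map (CommRingCat.ofHom (algebraMap O ((homogeneousSubmodule (Fin (n + 1)) O) 0)))) := by
  have hφX : ∀ i : Fin (n + 1), φ (X i) = X i := fun i => by rw [hφ, map_X]
  have hφF : ∀ l, φ (F l) = f l := fun l => by rw [hφ, hFf]
  set Ck := projIdealSheaf (homogeneousSubmodule (Fin (n + 1)) k)
    ⟨Ideal.span (Set.range f), isHomogeneous_span_of_forall_mem _ f d hf⟩ with hCk
  have h : EmbeddedLift.LiftsEmbedded φ hφ' Ck.subschemeι
      (projIdealSheaf (homogeneousSubmodule (Fin (n + 1)) O)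
        ⟨Ideal.span (Set.range F), isHomogeneous_span_of_forall_mem _ F d hF⟩) := by
    refine ⟨hflat, ?_⟩
    rw [comap_projIdealSheaf_span φ hφ' hφX F f d hF hf hφF, Scheme.IdealSheafData.ker_subschemeι]
  have hS := smooth_subschemeι_projIdealSheaf_of_jacobian f d hf hJ
  exact EmbeddedLift.LiftsEmbedded.smooth π hπ hφ h hS

end Smooth

end CILift

end Summit.ResolutionOfSingularities.ResolutionOfSingularities.Cruxes.EquisingularLiftNat.Sections

end
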